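import Summits.QuantumFields.YangMills.Theorems.ColdStartUniversalityLatticeLangevinHypercontractivityIff
import Summits.QuantumFields.YangMills.Theorems.ColdStartUniversalityUniformColdStartMixingOfLogSobolevStub
import Summits.QuantumFields.YangMills.Theorems.ColdStartUniversalityUniformColdStartMixingRungOfHarris
import HarnessLib

/-!
# Route `ColdStartUniversality`, crux K_A1 `UniformColdStartMixing` (stmt-QuantumFields-24809, aside), LINE 4 «cold_entropy»:
# the K-uniform log-Sobolev input (ULS) IN HYPERCONTRACTIVE CLOTHING — (UHC) K-uniform hypercontractivity in physical units ⇒ (ULS),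
# hence (UHC) + `stub_coldEntropyBudget` ⇒ the crux BY NAME

Helper file (seat `ym-line-csu-p1`, g36; `--supports stmt-QuantumFields-24809`).  g21 reduced the registered XL stub `stub_entropyDissipation`
to the K-uniform generator-form log-Sobolev inequality in physical units (ULS: constant `c·ε_K` at the `K`-th cut-off), and with the budget stub to the
crux (`UniformColdStartMixing_of_uniformLogSobolev_of_budget`).  Gross's equivalence at each fixed cut-off
(`generatorLogSobolev_iff_hypercontractive`, g36) lets the SAME input be stated on the `Lᵖ` side:
* (UHC) — there is `γ₁ > 0` such that for all `F`, `0 < γ ≤ γ₁` there are `c > 0`, `K₀` with: for every `K ≥ K₀` and every Markov kernel family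
  `κ` realising the SZZ transition laws at `β'_K = (γε_K)⁻¹/2` on the `K`-th lattice, `‖κ_t G‖_{1+e^{4cε_K t}} ≤ ‖G‖₂` for every positive `C³`
  compactly supported cylinder `G` and every lattice time `t` — hypercontractivity with the PHYSICAL-units constant `ρ_K = c·ε_K`
  (`e^{4cε_K t} = e^{4c·t_phys}`, `t_phys = ε_K t`);
* ★★ `uniformLogSobolev_of_uniformHypercontractivity` — (UHC) ⇒ (ULS) (THE realising kernels exist, `exists_transitionKernel`; Gross's `Iff`);
* ★★ `UniformColdStartMixing_of_uniformHypercontractivity_of_budget` — (UHC) + `stub_coldEntropyBudget` ⇒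
  `Summit.QuantumFields.YangMills.Theses.ColdStartUniversality.UniformColdStartMixing`.

HONEST FRAMING: a RESTATEMENT of the open K-uniform input of LINE 4 in another (equivalent, by Gross) currency, for the planner of record;
(UHC) holds at each FIXED cut-off with `ρ = ½e^{−4|β'_K|#𝒫_K}` (`wilson_hypercontractivity_explicit`), which is NOT of the form `c·ε_K` uniformly
in `K`; (UHC) is OPEN and at least as hard as the crux; item 24809 is ASIDE and NOT restated; nothing K-uniform is proved; no crux, rung or summit
statement is proved; the Yang–Mills mass gap is NOT proved.  THEOREMS ONLY, no definition, no sorry.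
-/

set_option autoImplicit false

noncomputable section

namespace Summit.QuantumFields.YangMills.Theorems.ColdStartUniversality

open MeasureTheory ProbabilityTheory
open scoped BigOperators NNReal ENNReal
open Literature.Probability.Process Literature.MathematicalPhysics.QuantumFieldTheory
open Literature.MathematicalPhysics.QuantumLattice (fundamentalRep fundamentalLatticeRep continuous_fundamentalRep)
open Literature.MathematicalPhysics.QuantumFieldTheory.Balaban1983to89

/-- ★★ **(UHC) ⇒ (ULS)**: K-uniform hypercontractivity of the SZZ semigroups in physical units (`‖κ_t‖_{2 → 1+e^{4cε_Kt}} ≤ 1` on positive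
`C³` cylinders, every realising kernel family, every `K ≥ K₀`) implies the K-uniform generator-form log-Sobolev inequality with the same
constant `c·ε_K` (`generatorLogSobolev_iff_hypercontractive` at each cut-off, applied to THE kernels of `exists_transitionKernel`).
[cite: DiaconisSaloffcoste1996, Theorem 3.5 (i)] -/
theorem uniformLogSobolev_of_uniformHypercontractivity
    (hUHC : (∃ γ₁ : ℝ, 0 < γ₁ ∧ ∀ (F : T3ContinuumYM3Torus.T3Family) (γ : ℝ), 0 < γ → γ ≤ γ₁ →
      ∃ c : ℝ, 0 < c ∧ ∃ K₀ : ℕ, ∀ K : ℕ, K₀ ≤ K →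
        ∀ (κ : ℝ≥0 → Kernel (GaugeConfig 3 ((F.P K).sitesPerDir 0) (Matrix.specialUnitaryGroup (Fin 2) ℂ))
            (GaugeConfig 3 ((F.P K).sitesPerDir 0) (Matrix.specialUnitaryGroup (Fin 2) ℂ))), (∀ t, IsMarkovKernel (κ t)) →
          (∀ (t : ℝ≥0) (x : GaugeConfig 3 ((F.P K).sitesPerDir 0) (Matrix.specialUnitaryGroup (Fin 2) ℂ))
              (Ω : Type) [MeasurableSpace Ω] (P : Measure Ω) [IsProbabilityMeasure P]
              (W : ℝ≥0 → Ω → (Edge 3 ((F.P K).sitesPerDir 0) × NoiseIdx 2 → ℝ)) (hW : IsFlatBrownian W P)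
              (U : ℝ≥0 → Ω → GaugeConfig 3 ((F.P K).sitesPerDir 0) (Matrix.specialUnitaryGroup (Fin 2) ℂ)),
              (∀ ω, U 0 ω = x) →
              (latticeLangevinDynamics (fundamentalLatticeRep 2) ((γ * (F.P K).eps)⁻¹ / 2)).IsSolution (fundamentalRep (Fin 2))
                hW.natFiltration P W U →
              κ t x = P.map (U t)) →
          ∀ (g : (Edge 3 ((F.P K).sitesPerDir 0) × Fin 2 × Fin 2 × Bool → ℝ) → ℝ), ContDiff ℝ 3 g → HasCompactSupport g →
            (∀ x : GaugeConfig 3 ((F.P K).sitesPerDir 0) (Matrix.specialUnitaryGroup (Fin 2) ℂ),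
              0 < g (fun q => (fun z : ℂ => if q.2.2.2 then z.im else z.re)
                ((fundamentalRep (Fin 2) (x q.1) : Matrix (Fin 2) (Fin 2) ℂ) q.2.1 q.2.2.1))) →
            ∀ t : ℝ≥0,
              (∫ x, (∫ y, g (fun q => (fun z : ℂ => if q.2.2.2 then z.im else z.re)
                  ((fundamentalRep (Fin 2) (y q.1) : Matrix (Fin 2) (Fin 2) ℂ) q.2.1 q.2.2.1)) ∂(κ t x)) ^
                  (1 + Real.exp (4 * (c * (F.P K).eps) * t))
                  ∂(wilsonMeasure (d := 3) (L := ((F.P K).sitesPerDir 0)) (fundamentalRep (Fin 2)) ((γ * (F.P K).eps)⁻¹ / 2))) ^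
                  (1 / (1 + Real.exp (4 * (c * (F.P K).eps) * t))) ≤
                (∫ x, g (fun q => (fun z : ℂ => if q.2.2.2 then z.im else z.re)
                  ((fundamentalRep (Fin 2) (x q.1) : Matrix (Fin 2) (Fin 2) ℂ) q.2.1 q.2.2.1)) ^ (2 : ℝ)
                  ∂(wilsonMeasure (d := 3) (L := ((F.P K).sitesPerDir 0)) (fundamentalRep (Fin 2)) ((γ * (F.P K).eps)⁻¹ / 2))) ^ (1 / (2 : ℝ)))) :
    (∃ γ₁ : ℝ, 0 < γ₁ ∧ ∀ (F : T3ContinuumYM3Torus.T3Family) (γ : ℝ), 0 < γ → γ ≤ γ₁ →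
      ∃ c : ℝ, 0 < c ∧ ∃ K₀ : ℕ, ∀ K : ℕ, K₀ ≤ K →
        ∀ (f : (Edge 3 ((F.P K).sitesPerDir 0) × Fin 2 × Fin 2 × Bool → ℝ) → ℝ), ContDiff ℝ 3 f →
        let coords : GaugeConfig 3 ((F.P K).sitesPerDir 0) (Matrix.specialUnitaryGroup (Fin 2) ℂ) →
            (Edge 3 ((F.P K).sitesPerDir 0) × Fin 2 × Fin 2 × Bool → ℝ) :=
          fun V q => (fun z : ℂ => if q.2.2.2 then z.im else z.re)
            ((fundamentalRep (Fin 2) (V q.1) : Matrix (Fin 2) (Fin 2) ℂ) q.2.1 q.2.2.1)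
        let gen : GaugeConfig 3 ((F.P K).sitesPerDir 0) (Matrix.specialUnitaryGroup (Fin 2) ℂ) → ℝ := fun V =>
          (∑ i : Edge 3 ((F.P K).sitesPerDir 0) × Fin 2 × Fin 2 × Bool, fderiv ℝ f (coords V) (Pi.single i 1) *
              (fun z : ℂ => if i.2.2.2 then z.im else z.re)
                ((latticeLangevinDynamics (fundamentalLatticeRep 2) ((γ * (F.P K).eps)⁻¹ / 2)).drift
                  (matrixConfig (fundamentalRep (Fin 2)) V) i.1 i.2.1 i.2.2.1) +
          1 / 2 * ∑ i : Edge 3 ((F.P K).sitesPerDir 0) × Fin 2 × Fin 2 × Bool,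
            ∑ j : Edge 3 ((F.P K).sitesPerDir 0) × Fin 2 × Fin 2 × Bool,
            fderiv ℝ (fun z => fderiv ℝ f z (Pi.single i 1)) (coords V) (Pi.single j 1) *
              ∑ n : Edge 3 ((F.P K).sitesPerDir 0) × NoiseIdx 2,
                (if n.1 = i.1 then (fun z : ℂ => if i.2.2.2 then z.im else z.re)
                  ((latticeLangevinDynamics (fundamentalLatticeRep 2) ((γ * (F.P K).eps)⁻¹ / 2)).noise
                    (matrixConfig (fundamentalRep (Fin 2)) V) i.1 n.2 i.2.1 i.2.2.1) else 0) *
                (if n.1 = j.1 then (fun z : ℂ => if j.2.2.2 then z.im else z.re)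
                  ((latticeLangevinDynamics (fundamentalLatticeRep 2) ((γ * (F.P K).eps)⁻¹ / 2)).noise
                    (matrixConfig (fundamentalRep (Fin 2)) V) j.1 n.2 j.2.1 j.2.2.1) else 0))
        c * (F.P K).eps *
            ((∫ V, f (coords V) ^ 2 * Real.log (f (coords V) ^ 2)
                ∂(wilsonMeasure (d := 3) (L := ((F.P K).sitesPerDir 0)) (fundamentalRep (Fin 2)) ((γ * (F.P K).eps)⁻¹ / 2))) -
              (∫ V, f (coords V) ^ 2
                ∂(wilsonMeasure (d := 3) (L := ((F.P K).sitesPerDir 0)) (fundamentalRep (Fin 2)) ((γ * (F.P K).eps)⁻¹ / 2))) *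
                Real.log (∫ V, f (coords V) ^ 2
                  ∂(wilsonMeasure (d := 3) (L := ((F.P K).sitesPerDir 0)) (fundamentalRep (Fin 2)) ((γ * (F.P K).eps)⁻¹ / 2)))) ≤
          -∫ V, f (coords V) * gen V
            ∂(wilsonMeasure (d := 3) (L := ((F.P K).sitesPerDir 0)) (fundamentalRep (Fin 2)) ((γ * (F.P K).eps)⁻¹ / 2))) := by
  obtain ⟨γ₁, hγ₁, h⟩ := hUHC
  refine ⟨γ₁, hγ₁, fun F γ hγ hγle => ?_⟩
  obtain ⟨c, hc, K₀, hK⟩ := h F γ hγ hγle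
  refine ⟨c, hc, K₀, fun K hKK f hf => ?_⟩
  obtain ⟨κ, hκM, -, hreal⟩ := exists_transitionKernel ((F.P K).sitesPerDir 0) ((γ * (F.P K).eps)⁻¹ / 2)
  haveI := hκM
  have hρ : 0 ≤ c * (F.P K).eps := (mul_pos hc (F.P K).eps_pos).le
  have hHC := hK K hKK κ hκM hreal
  exact (generatorLogSobolev_iff_hypercontractive ((F.P K).sitesPerDir 0) ((γ * (F.P K).eps)⁻¹ / 2) κ hreal hρ).2 hHC f hf

/-- ★★ **The crux BY NAME from (UHC) and the registered entropy-budget stub**: K-uniform hypercontractivity in physical units together with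
`stub_coldEntropyBudget` implies `UniformColdStartMixing` (`uniformLogSobolev_of_uniformHypercontractivity` +
`UniformColdStartMixing_of_uniformLogSobolev_of_budget`).  HONEST: both hypotheses are OPEN and K-uniform; nothing is discharged here. -/
theorem UniformColdStartMixing_of_uniformHypercontractivity_of_budget
    (hUHC : (∃ γ₁ : ℝ, 0 < γ₁ ∧ ∀ (F : T3ContinuumYM3Torus.T3Family) (γ : ℝ), 0 < γ → γ ≤ γ₁ →
      ∃ c : ℝ, 0 < c ∧ ∃ K₀ : ℕ, ∀ K : ℕ, K₀ ≤ K →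
        ∀ (κ : ℝ≥0 → Kernel (GaugeConfig 3 ((F.P K).sitesPerDir 0) (Matrix.specialUnitaryGroup (Fin 2) ℂ))
            (GaugeConfig 3 ((F.P K).sitesPerDir 0) (Matrix.specialUnitaryGroup (Fin 2) ℂ))), (∀ t, IsMarkovKernel (κ t)) →
          (∀ (t : ℝ≥0) (x : GaugeConfig 3 ((F.P K).sitesPerDir 0) (Matrix.specialUnitaryGroup (Fin 2) ℂ))
              (Ω : Type) [MeasurableSpace Ω] (P : Measure Ω) [IsProbabilityMeasure P]
              (W : ℝ≥0 → Ω → (Edge 3 ((F.P K).sitesPerDir 0) × NoiseIdx 2 → ℝ)) (hW : IsFlatBrownian W P)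
              (U : ℝ≥0 → Ω → GaugeConfig 3 ((F.P K).sitesPerDir 0) (Matrix.specialUnitaryGroup (Fin 2) ℂ)),
              (∀ ω, U 0 ω = x) →
              (latticeLangevinDynamics (fundamentalLatticeRep 2) ((γ * (F.P K).eps)⁻¹ / 2)).IsSolution (fundamentalRep (Fin 2))
                hW.natFiltration P W U →
              κ t x = P.map (U t)) →
          ∀ (g : (Edge 3 ((F.P K).sitesPerDir 0) × Fin 2 × Fin 2 × Bool → ℝ) → ℝ), ContDiff ℝ 3 g → HasCompactSupport g →
            (∀ x : GaugeConfig 3 ((F.P K).sitesPerDir 0) (Matrix.specialUnitaryGroup (Fin 2) ℂ),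
              0 < g (fun q => (fun z : ℂ => if q.2.2.2 then z.im else z.re)
                ((fundamentalRep (Fin 2) (x q.1) : Matrix (Fin 2) (Fin 2) ℂ) q.2.1 q.2.2.1))) →
            ∀ t : ℝ≥0,
              (∫ x, (∫ y, g (fun q => (fun z : ℂ => if q.2.2.2 then z.im else z.re)
                  ((fundamentalRep (Fin 2) (y q.1) : Matrix (Fin 2) (Fin 2) ℂ) q.2.1 q.2.2.1)) ∂(κ t x)) ^
                  (1 + Real.exp (4 * (c * (F.P K).eps) * t))
                  ∂(wilsonMeasure (d := 3) (L := ((F.P K).sitesPerDir 0)) (fundamentalRep (Fin 2)) ((γ * (F.P K).eps)⁻¹ / 2))) ^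
                  (1 / (1 + Real.exp (4 * (c * (F.P K).eps) * t))) ≤
                (∫ x, g (fun q => (fun z : ℂ => if q.2.2.2 then z.im else z.re)
                  ((fundamentalRep (Fin 2) (x q.1) : Matrix (Fin 2) (Fin 2) ℂ) q.2.1 q.2.2.1)) ^ (2 : ℝ)
                  ∂(wilsonMeasure (d := 3) (L := ((F.P K).sitesPerDir 0)) (fundamentalRep (Fin 2)) ((γ * (F.P K).eps)⁻¹ / 2))) ^ (1 / (2 : ℝ))))
    (hBudget : Summit.QuantumFields.YangMills.Cruxes.UniformColdStartMixing.ColdEntropy.__Registered.stub_coldEntropyBudget) :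
    Summit.QuantumFields.YangMills.Theses.ColdStartUniversality.UniformColdStartMixing :=
  UniformColdStartMixing_of_uniformLogSobolev_of_budget (uniformLogSobolev_of_uniformHypercontractivity hUHC) hBudget

end Summit.QuantumFields.YangMills.Theorems.ColdStartUniversality

end
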